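import Mathlib
import HarnessLib

/-!
# PneNP / OverlapGapAlgebra — `SearchHardWindow`: occurrence-local rung, the Hall computation

Support for crux `stmt-PneNP-2460` (`Summit.PneNP.PneNP.Theses.OverlapGapAlgebra.SearchHardWindow`),
eighth file of the OCCURRENCE-LOCAL RUNG (prefix `shwL_`) — the probabilistic half of its
TIGHTNESS COMPANION (`…LocalRungTightness.lean`): the variable pattern of `F_k(n, ⌊αn⌋)` is
MATCHABLE (its clause hypergraph has a system of distinct representatives) with probability
`1 - O(1/n)` whenever `e² α^{k-1} < 1`, `k ≥ 2`.

* `shwL_card_slotsInto_mul` — patterns sending a set `P` of slots into a set `T` of variables: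
  exactly `#T^{#P} · n^{mk - #P}` (`Fintype.card_piFinset`);
* `shwL_ratio_notMatchable_le` — Hall's theorem (`Finset.all_card_le_biUnion_card_iff_exists_injective`)
  + union bound: `Pr[not matchable] ≤ Σ_{t<m} C(m,t+1) C(n,t) (t/n)^{k(t+1)}` (`m ≤ n + 1`);
* `shwL_hallTerm_le`, `shwL_sum_hallTerms_le` — `C(m,s) ≤ (eαn/s)^s`, `C(n,t) ≤ (en/t)^t`
  (`Nat.choose_le_pow_div`, `Real.pow_div_factorial_le_exp`) give the termwise bound
  `r^{t+1}(t+1)/n`, `r = e² α^{k-1}`, and `Σ s r^s = r/(1-r)²` (`tsum_coe_mul_geometric_of_norm_lt_one`)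
  gives `Pr[not matchable] ≤ (r/(1-r)²)/n` when `m ≤ αn`.

No definitions; axioms `propext`, `Classical.choice`, `Quot.sound`.
-/

set_option linter.dupNamespace false -- `Summit.PneNP.PneNP.…`: summit = sub-problem (D-0017)

namespace Summit.PneNP.PneNP.Theorems

open Finset

section SlotsInto

variable {m k n : ℕ}

/-- **Prescribing the variables of a set of slots.** The variable patterns sending every slot of
`P` into the variable set `T` number exactly `#T^{#P} · n^{mk - #P}`; multiplied by `n^{#P}`:
`#{V : ∀ a ∈ P, V a ∈ T} · n^{#P} = #T^{#P} · n^{mk}`. -/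
theorem shwL_card_slotsInto_mul (P : Finset (Fin m × Fin k)) (T : Finset (Fin n)) :
    (univ.filter fun V : Fin m × Fin k → Fin n => ∀ a ∈ P, V a ∈ T).card * n ^ P.card
      = T.card ^ P.card * n ^ (m * k) := by
  have hset : (univ.filter fun V : Fin m × Fin k → Fin n => ∀ a ∈ P, V a ∈ T)
      = Fintype.piFinset fun a : Fin m × Fin k => if a ∈ P then T else univ := by
    ext V
    simp only [mem_filter, mem_univ, true_and, Fintype.mem_piFinset]
    constructor
    · intro h a
      split_ifs with ha
      · exact h a ha
      · exact mem_univ _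
    · intro h a ha
      have := h a
      rwa [if_pos ha] at this
  rw [hset, Fintype.card_piFinset]
  have hprod : (∏ a : Fin m × Fin k, (if a ∈ P then T else univ).card)
      = T.card ^ P.card * n ^ (m * k - P.card) := by
    have : ∀ a : Fin m × Fin k, (if a ∈ P then T else (univ : Finset (Fin n))).card
        = if a ∈ P then T.card else n := by
      intro a; split_ifs <;> simp
    simp_rw [this]
    rw [prod_ite, prod_const, prod_const]
    congr 2
    · congr 1; ext a; simp
    · rw [filter_not, card_sdiff_of_subset (filter_subset _ _), card_univ, Fintype.card_prod,
        Fintype.card_fin, Fintype.card_fin]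
      congr 2; ext a; simp
  rw [hprod, mul_assoc, ← pow_add]
  congr 2
  have : P.card ≤ m * k := by
    calc P.card ≤ (univ : Finset (Fin m × Fin k)).card := card_le_univ _
      _ = m * k := by rw [card_univ, Fintype.card_prod, Fintype.card_fin, Fintype.card_fin]
  omega

end SlotsInto

section HallBound

variable {m k n : ℕ}

/-- **No system of distinct representatives ⟹ a Hall violator (union bound).** Call a variable
pattern `V` of `F_k(n, m)` MATCHABLE if some injective `f : clauses → variables` picks a variable
of each clause (a system of distinct representatives of the clause hypergraph). If `m ≤ n + 1`,
the non-matchable patterns are a fraction at most `Σ_{t < m} C(m, t+1) · C(n, t) · (t/n)^{k(t+1)}`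
of all patterns: by Hall's theorem some `t + 1` clauses have all their `k(t+1)` slots in a set of
`t` variables. -/
theorem shwL_ratio_notMatchable_le (hn : 0 < n) (hmn : m ≤ n + 1) :
    ((univ.filter fun V : Fin m × Fin k → Fin n =>
        ¬ ∃ f : Fin m → Fin n, Function.Injective f ∧ ∀ i, ∃ j, V (i, j) = f i).card : ℝ)
        / Fintype.card (Fin m × Fin k → Fin n)
      ≤ ∑ t ∈ range m, ((m.choose (t + 1) * n.choose t : ℕ) : ℝ) * ((t : ℝ) / n) ^ (k * (t + 1)) := by
  -- Hall: a non-matchable pattern has `t + 1` clauses whose slots all lie in a `t`-set of variables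
  have hsub : (univ.filter fun V : Fin m × Fin k → Fin n =>
      ¬ ∃ f : Fin m → Fin n, Function.Injective f ∧ ∀ i, ∃ j, V (i, j) = f i)
        ⊆ (range m).biUnion fun t => ((univ : Finset (Fin m)).powersetCard (t + 1)).biUnion fun S =>
            ((univ : Finset (Fin n)).powersetCard t).biUnion fun T =>
              univ.filter fun V : Fin m × Fin k → Fin n => ∀ a ∈ S ×ˢ (univ : Finset (Fin k)), V a ∈ T := by
    intro V hV
    simp only [mem_filter, mem_univ, true_and] at hV
    have hHall : ¬ ∀ S : Finset (Fin m),
        S.card ≤ (S.biUnion fun i => (univ : Finset (Fin k)).image fun j => V (i, j)).card := by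
      intro hall
      obtain ⟨f, hf, hmem⟩ := (Finset.all_card_le_biUnion_card_iff_exists_injective
        (fun i => (univ : Finset (Fin k)).image fun j => V (i, j))).1 hall
      refine hV ⟨f, hf, fun i => ?_⟩
      obtain ⟨j, -, hj⟩ := mem_image.1 (hmem i)
      exact ⟨j, hj⟩
    push Not at hHall
    obtain ⟨S, hS⟩ := hHall
    have hSpos : 0 < S.card := by
      rcases S.eq_empty_or_nonempty with h | h
      · subst h; simp at hS
      · exact h.card_pos
    -- enlarge the variable set of `S` to exactly `#S - 1` variables
    obtain ⟨T, hvarsT, -, hTcard⟩ := exists_subsuperset_card_eq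
      (subset_univ (S.biUnion fun i => (univ : Finset (Fin k)).image fun j => V (i, j)))
      (Nat.le_sub_one_of_lt hS)
      (show S.card - 1 ≤ (univ : Finset (Fin n)).card by
        rw [card_univ, Fintype.card_fin]
        have := card_le_univ S; rw [Fintype.card_fin] at this; omega)
    simp only [mem_biUnion, mem_range, mem_powersetCard, mem_filter, mem_univ, true_and]
    refine ⟨S.card - 1, ?_, S, ⟨subset_univ _, by omega⟩, T, ⟨subset_univ _, hTcard⟩, ?_⟩
    · have := card_le_univ S; rw [Fintype.card_fin] at this; omega
    · intro a ha
      rw [mem_product] at ha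
      exact hvarsT (mem_biUnion.2 ⟨a.1, ha.1, mem_image.2 ⟨a.2, mem_univ _, rfl⟩⟩)
  have hNV : (0 : ℝ) < Fintype.card (Fin m × Fin k → Fin n) := by
    haveI : Nonempty (Fin n) := ⟨⟨0, hn⟩⟩
    exact_mod_cast Fintype.card_pos
  have hn' : (0 : ℝ) < n := by exact_mod_cast hn
  rw [div_le_iff₀ hNV, sum_mul]
  calc ((univ.filter fun V : Fin m × Fin k → Fin n =>
        ¬ ∃ f : Fin m → Fin n, Function.Injective f ∧ ∀ i, ∃ j, V (i, j) = f i).card : ℝ)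
      ≤ ∑ t ∈ range m, ∑ S ∈ (univ : Finset (Fin m)).powersetCard (t + 1),
          ∑ T ∈ (univ : Finset (Fin n)).powersetCard t,
            ((univ.filter fun V : Fin m × Fin k → Fin n =>
              ∀ a ∈ S ×ˢ (univ : Finset (Fin k)), V a ∈ T).card : ℝ) := by
        have h1 := (card_le_card hsub).trans card_biUnion_le
        refine (Nat.cast_le.2 h1).trans ?_
        push_cast
        refine sum_le_sum fun t _ => ?_
        have h2 : (((univ : Finset (Fin m)).powersetCard (t + 1)).biUnion fun S =>
            ((univ : Finset (Fin n)).powersetCard t).biUnion fun T =>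
              univ.filter fun V : Fin m × Fin k → Fin n =>
                ∀ a ∈ S ×ˢ (univ : Finset (Fin k)), V a ∈ T).card
            ≤ ∑ S ∈ (univ : Finset (Fin m)).powersetCard (t + 1),
                (((univ : Finset (Fin n)).powersetCard t).biUnion fun T =>
                  univ.filter fun V : Fin m × Fin k → Fin n =>
                    ∀ a ∈ S ×ˢ (univ : Finset (Fin k)), V a ∈ T).card := card_biUnion_le
        refine (Nat.cast_le.2 h2).trans ?_
        push_cast
        refine sum_le_sum fun S _ => ?_
        exact_mod_cast card_biUnion_le
    _ = ∑ t ∈ range m, ((m.choose (t + 1) * n.choose t : ℕ) : ℝ) * ((t : ℝ) / n) ^ (k * (t + 1))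
          * Fintype.card (Fin m × Fin k → Fin n) := by
        refine sum_congr rfl fun t _ => ?_
        have hterm : ∀ S ∈ (univ : Finset (Fin m)).powersetCard (t + 1),
            ∀ T ∈ (univ : Finset (Fin n)).powersetCard t,
              ((univ.filter fun V : Fin m × Fin k → Fin n =>
                ∀ a ∈ S ×ˢ (univ : Finset (Fin k)), V a ∈ T).card : ℝ)
                = ((t : ℝ) / n) ^ (k * (t + 1)) * Fintype.card (Fin m × Fin k → Fin n) := by
          intro S hS T hT
          rw [mem_powersetCard] at hS hT
          have h := shwL_card_slotsInto_mul (S ×ˢ (univ : Finset (Fin k))) T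
          rw [card_product, card_univ, Fintype.card_fin, hS.2, hT.2] at h
          have hR : ((univ.filter fun V : Fin m × Fin k → Fin n =>
              ∀ a ∈ S ×ˢ (univ : Finset (Fin k)), V a ∈ T).card : ℝ) * (n : ℝ) ^ ((t + 1) * k)
                = (t : ℝ) ^ ((t + 1) * k) * (n : ℝ) ^ (m * k) := by exact_mod_cast h
          have hcard : (Fintype.card (Fin m × Fin k → Fin n) : ℝ) = (n : ℝ) ^ (m * k) := by
            rw [Fintype.card_fun, Fintype.card_prod, Fintype.card_fin, Fintype.card_fin,
              Fintype.card_fin]; push_cast; ring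
          rw [hcard, div_pow, mul_comm k (t + 1)]
          field_simp
          linarith [hR]
        rw [sum_congr rfl fun S hS => sum_congr rfl fun T hT => hterm S hS T hT]
        simp only [sum_const, card_powersetCard, card_univ, Fintype.card_fin, nsmul_eq_mul]
        push_cast
        ring

end HallBound

section HallAnalytic

open Real

/-- **One Hall term.** For `2 ≤ k`, `0 < α`, `m ≤ αn`, `1 ≤ t < m`:
`C(m, t+1) · C(n, t) · (t/n)^{k(t+1)} ≤ r^{t+1} · (t+1)/n` with `r = e² α^{k-1}` — from
`C(m,s) ≤ (eαn/s)^s`, `C(n,t) ≤ (en/t)^t` and `t ≤ t + 1 ≤ m ≤ αn`. -/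
theorem shwL_hallTerm_le (k : ℕ) (hk : 2 ≤ k) (α : ℝ) (hα : 0 < α) {m n t : ℕ} (hn : 0 < n)
    (hm : (m : ℝ) ≤ α * n) (ht : 1 ≤ t) (htm : t < m) :
    ((m.choose (t + 1) * n.choose t : ℕ) : ℝ) * ((t : ℝ) / n) ^ (k * (t + 1))
      ≤ (Real.exp 2 * α ^ (k - 1)) ^ (t + 1) * ((t : ℝ) + 1) / n := by
  obtain ⟨k', rfl⟩ : ∃ k', k = k' + 2 := ⟨k - 2, by omega⟩
  rw [show k' + 2 - 1 = k' + 1 by omega]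
  set s : ℕ := t + 1 with hs
  have hn' : (0 : ℝ) < n := by exact_mod_cast hn
  have ht' : (1 : ℝ) ≤ t := by exact_mod_cast ht
  have htpos : (0 : ℝ) < t := by linarith
  have hspos : (0 : ℝ) < s := by rw [hs]; push_cast; linarith
  have hts : (t : ℝ) ≤ s := by rw [hs]; push_cast; linarith
  have hsm : (s : ℝ) ≤ m := by exact_mod_cast (show s ≤ m by omega)
  have htn : (t : ℝ) / n ≤ α := by
    rw [div_le_iff₀ hn']; linarith
  have htn0 : 0 ≤ (t : ℝ) / n := by positivity
  have he : (1 : ℝ) ≤ Real.exp 1 := Real.one_le_exp (by norm_num)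
  -- binomial bounds
  have hchoose1 : (m.choose s : ℝ) ≤ (Real.exp 1 * (α * n) / s) ^ s := by
    have h1 : (m.choose s : ℝ) ≤ (m : ℝ) ^ s / s.factorial := by
      have := Nat.choose_le_pow_div (α := ℝ) s m; exact_mod_cast this
    have h2 : (s : ℝ) ^ s / s.factorial ≤ Real.exp s := by
      have := Real.pow_div_factorial_le_exp (x := (s : ℝ)) (by positivity) s
      simpa using this
    have hfac : (0 : ℝ) < s.factorial := by exact_mod_cast Nat.factorial_pos s
    calc (m.choose s : ℝ) ≤ (m : ℝ) ^ s / s.factorial := h1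
      _ ≤ (α * n) ^ s / s.factorial := by gcongr
      _ = (α * n / s) ^ s * ((s : ℝ) ^ s / s.factorial) := by
          rw [div_pow]; field_simp
      _ ≤ (α * n / s) ^ s * Real.exp s := mul_le_mul_of_nonneg_left h2 (by positivity)
      _ = (Real.exp 1 * (α * n) / s) ^ s := by
          rw [← Real.exp_one_pow s, mul_comm]; ring
  have hchoose2 : (n.choose t : ℝ) ≤ (Real.exp 1 * n / t) ^ t := by
    have h1 : (n.choose t : ℝ) ≤ (n : ℝ) ^ t / t.factorial := by
      have := Nat.choose_le_pow_div (α := ℝ) t n; exact_mod_cast this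
    have h2 : (t : ℝ) ^ t / t.factorial ≤ Real.exp t := by
      have := Real.pow_div_factorial_le_exp (x := (t : ℝ)) (by positivity) t
      simpa using this
    have hfac : (0 : ℝ) < t.factorial := by exact_mod_cast Nat.factorial_pos t
    calc (n.choose t : ℝ) ≤ (n : ℝ) ^ t / t.factorial := h1
      _ = ((n : ℝ) / t) ^ t * ((t : ℝ) ^ t / t.factorial) := by rw [div_pow]; field_simp
      _ ≤ ((n : ℝ) / t) ^ t * Real.exp t := mul_le_mul_of_nonneg_left h2 (by positivity)
      _ = (Real.exp 1 * n / t) ^ t := by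
          rw [← Real.exp_one_pow t, mul_comm]; ring
  -- split the exponent: k s = k' s + (s + 1) + t
  have hexp : (k' + 2) * (t + 1) = k' * s + ((s + 1) + t) := by rw [hs]; ring
  rw [hexp, pow_add, pow_add]
  -- the three factors
  have f1 : ((t : ℝ) / n) ^ (k' * s) ≤ α ^ (k' * s) := pow_le_pow_left₀ htn0 htn _
  have f2 : (Real.exp 1 * (α * n) / s) ^ s * ((t : ℝ) / n) ^ (s + 1)
      ≤ (Real.exp 1 * α) ^ s * ((s : ℝ) / n) := by
    have hid : (Real.exp 1 * (α * n) / s) ^ s * ((t : ℝ) / n) ^ (s + 1)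
        = (Real.exp 1 * α * (t / s)) ^ s * ((t : ℝ) / n) := by
      have hmul : Real.exp 1 * (α * n) / s * ((t : ℝ) / n) = Real.exp 1 * α * (t / s) := by
        field_simp
      rw [pow_succ ((t : ℝ) / n) s, ← mul_assoc, ← mul_pow, hmul]
    rw [hid]
    have hts1 : (t : ℝ) / s ≤ 1 := (div_le_one hspos).2 hts
    calc (Real.exp 1 * α * (t / s)) ^ s * ((t : ℝ) / n)
        ≤ (Real.exp 1 * α) ^ s * ((t : ℝ) / n) := by
          refine mul_le_mul_of_nonneg_right (pow_le_pow_left₀ (by positivity) ?_ _) htn0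
          exact mul_le_of_le_one_right (by positivity) hts1
      _ ≤ (Real.exp 1 * α) ^ s * ((s : ℝ) / n) := by
          refine mul_le_mul_of_nonneg_left ?_ (by positivity)
          exact div_le_div_of_nonneg_right hts hn'.le
  have f3 : (Real.exp 1 * n / t) ^ t * ((t : ℝ) / n) ^ t ≤ Real.exp 1 ^ s := by
    rw [← mul_pow]
    have hid : Real.exp 1 * n / t * ((t : ℝ) / n) = Real.exp 1 := by field_simp
    rw [hid]
    exact pow_le_pow_right₀ he (by omega)
  -- assemble
  have hprod : ((m.choose s * n.choose t : ℕ) : ℝ)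
      ≤ (Real.exp 1 * (α * n) / s) ^ s * (Real.exp 1 * n / t) ^ t := by
    push_cast
    exact mul_le_mul hchoose1 hchoose2 (Nat.cast_nonneg _) (by positivity)
  calc ((m.choose s * n.choose t : ℕ) : ℝ) * (((t : ℝ) / n) ^ (k' * s)
        * ((((t : ℝ) / n) ^ (s + 1)) * ((t : ℝ) / n) ^ t))
      ≤ ((Real.exp 1 * (α * n) / s) ^ s * (Real.exp 1 * n / t) ^ t) * (((t : ℝ) / n) ^ (k' * s)
        * ((((t : ℝ) / n) ^ (s + 1)) * ((t : ℝ) / n) ^ t)) :=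
          mul_le_mul_of_nonneg_right hprod (by positivity)
    _ = ((t : ℝ) / n) ^ (k' * s) * ((Real.exp 1 * (α * n) / s) ^ s * ((t : ℝ) / n) ^ (s + 1))
        * ((Real.exp 1 * n / t) ^ t * ((t : ℝ) / n) ^ t) := by ring
    _ ≤ α ^ (k' * s) * ((Real.exp 1 * α) ^ s * ((s : ℝ) / n)) * Real.exp 1 ^ s := by
          refine mul_le_mul (mul_le_mul f1 f2 (by positivity) (by positivity)) f3 (by positivity) ?_
          positivity
    _ = (Real.exp 2 * α ^ (k' + 1)) ^ s * ((t : ℝ) + 1) / n := by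
          have : Real.exp 2 = Real.exp 1 * Real.exp 1 := by rw [← Real.exp_add]; norm_num
          rw [this, hs]; push_cast; ring

/-- **The Hall sum is `O(1/n)`.** For `2 ≤ k`, `0 < α` with `r = e² α^{k-1} < 1` and `m ≤ αn`:
`Σ_{t < m} C(m, t+1) C(n, t) (t/n)^{k(t+1)} ≤ (r/(1-r)²)/n`. -/
theorem shwL_sum_hallTerms_le (k : ℕ) (hk : 2 ≤ k) (α : ℝ) (hα : 0 < α)
    (hr : Real.exp 2 * α ^ (k - 1) < 1) {m n : ℕ} (hn : 0 < n) (hm : (m : ℝ) ≤ α * n) :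
    ∑ t ∈ range m, ((m.choose (t + 1) * n.choose t : ℕ) : ℝ) * ((t : ℝ) / n) ^ (k * (t + 1))
      ≤ (Real.exp 2 * α ^ (k - 1)) / (1 - Real.exp 2 * α ^ (k - 1)) ^ 2 / n := by
  set r : ℝ := Real.exp 2 * α ^ (k - 1) with hrdef
  have hr0 : 0 ≤ r := by positivity
  have hn' : (0 : ℝ) < n := by exact_mod_cast hn
  have hnorm : ‖r‖ < 1 := by rw [Real.norm_of_nonneg hr0]; exact hr
  -- termwise
  have hterm : ∀ t ∈ range m, ((m.choose (t + 1) * n.choose t : ℕ) : ℝ) * ((t : ℝ) / n) ^ (k * (t + 1))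
      ≤ ((t + 1 : ℕ) : ℝ) * r ^ (t + 1) / n := by
    intro t htm
    rw [mem_range] at htm
    rcases Nat.eq_zero_or_pos t with h0 | hpos
    · subst h0
      have hk0 : k * (0 + 1) ≠ 0 := by omega
      rw [Nat.cast_zero, zero_div, zero_pow hk0, mul_zero]
      positivity
    · have := shwL_hallTerm_le k hk α hα hn hm hpos htm
      rw [← hrdef] at this
      calc _ ≤ r ^ (t + 1) * ((t : ℝ) + 1) / n := this
        _ = ((t + 1 : ℕ) : ℝ) * r ^ (t + 1) / n := by push_cast; ring
  -- sum and compare with the full series `Σ s r^s = r/(1-r)²`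
  have hsumm : Summable (fun s : ℕ => (s : ℝ) * r ^ s) := by
    have := summable_pow_mul_geometric_of_norm_lt_one 1 hnorm
    simpa using this
  calc ∑ t ∈ range m, ((m.choose (t + 1) * n.choose t : ℕ) : ℝ) * ((t : ℝ) / n) ^ (k * (t + 1))
      ≤ ∑ t ∈ range m, ((t + 1 : ℕ) : ℝ) * r ^ (t + 1) / n := sum_le_sum hterm
    _ = (∑ t ∈ range m, ((t + 1 : ℕ) : ℝ) * r ^ (t + 1)) / n := by rw [sum_div]
    _ ≤ (∑ s ∈ range (m + 1), (s : ℝ) * r ^ s) / n := by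
        refine div_le_div_of_nonneg_right ?_ hn'.le
        rw [Finset.sum_range_succ']
        simp
    _ ≤ (∑' s : ℕ, (s : ℝ) * r ^ s) / n := by
        refine div_le_div_of_nonneg_right ?_ hn'.le
        exact hsumm.sum_le_tsum (range (m + 1)) fun s _ => by positivity
    _ = r / (1 - r) ^ 2 / n := by rw [tsum_coe_mul_geometric_of_norm_lt_one hnorm]

end HallAnalytic

end Summit.PneNP.PneNP.Theorems
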